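import Mathlib
import HarnessLib
import Summits.NavierStokesRegularity.NavierStokesRegularity.Theorems.TaylorModelRungThreeCertificateIntervalDJetsArray

/-!
# Crux K1b-DR (stmt-NavierStokesRegularity-23954), line `taylor-model` — certificate SOUNDNESS tooling: the INTERVAL
# LINEAR-ALGEBRA KERNEL of the v3 (vector-step, frame-absorbed) checker, part 1 — readers, semantics, PRODUCTS
# (CERT-CONTRACT-23954 v3.1 §3 C3/C4, §4; PROPAGATE-V-SPEC-cert1 §2 D/E/F; director rulings dss_56/58/60)

Every variant of the v3 sub-step still on the table (three frame-radius vectors `rP⁰ ≤ rP¹ ≤ rP²` in one frame, v3.1; or a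
point matrix `P` plus one error frame `Bp`, cert-1 g2's revision) needs the same ARRAY-CODED linear-algebra primitives on the
rounded-dyadic interval layer of `…CertificateIntervalD` (`Dyad`, `IntervalD`, `roundOut prec`). This part:

* POINT matrices / vectors `Array (Array Dyad)` / `Array Dyad` (frames `Cm`, approximate inverses `X`, radii `rP`, error
  vectors `ν`) and INTERVAL matrices / vectors `Array (Array IntervalD)` / `Array IntervalD` (`[M_s]`, `CiBox`, `T_s`, `G_s`),
  read by `dget/dmget/imget` (junk zero beyond the size; every reader is used only below `n`), with their REAL semantics in
  window coordinates: `vre`, `dre`, and the predicates `MemMat n a M` / `MemVec n v V` (entrywise membership of a real matrix /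
  vector `a : ℕ → ℕ → ℝ`, `v : ℕ → ℝ`), `AbsLeMat` / `AbsLeVec` (entrywise absolute bounds) — the convention of
  `…CertificateSoundBridge` (`wv (linR A y) r = Σ_{c<n} A r c · wv y c`, `Finset.range n` sums);
* rounded scalar products with ZERO-SKIPPING (`IntervalD.mulZ/mulDZ/mulDD`: a factor that is the point `0` contributes the
  point `0` without a multiplication — frames and jets are shell-banded, ≈ 75 % zeros, S1-VECTOR-23954 §5.6);
* the matrix products interval × interval `mulII`, point × interval `mulDI`, interval × point `mulID`, the enclosure
  `oneSubMulDD` of `I − X·C` for two point matrices (input of the Neumann test of `…CertificateFrameNeumann`), each with its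
  INCLUSION theorem (`memMat_mulII` etc.: real `a ∈ M`, `b ∈ N` ⇒ `(Σ_t a r t · b t c) ∈ (M·N) r c`), and the rounded-DOWN
  point product `mulDDr` (for CHOSEN objects such as the frame update — no inclusion claim; PROPAGATE-V-SPEC §2 D «rounding
  free-for-all»).

Loops are structural recursions on `ℕ` over array rows (no `List.range` closures), rows hoisted and the right factor
pre-transposed, per the replay-cost measurements of S1-VECTOR-23954 §5.6 / engine-1 g66 08:48Z. Part 2
(`…IntervalDMatrixBounds`): magnitudes, upward products `|T|·rP`, row-sum and componentwise tests, `ciBox`.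
References: R. E. Moore, *Interval Analysis* (1966) Ch. 4; A. Neumaier, *Interval Methods for Systems of Equations* (1990)
§3.1 (interval matrix arithmetic is inclusion isotone). [folklore]
MODEL-lattice bookkeeping only (rung TL-M3, one finite-dimensional model ODE); nothing here concerns the Navier–Stokes equations.
-/

-- the sub-problem namespace repeats the summit name by design (D-0017)
set_option linter.dupNamespace false

namespace Summit.NavierStokesRegularity.NavierStokesRegularity.Theorems.TaylorModelCert

open scoped BigOperators

/-! ### Dyadic helpers: zero, one, directed-rounded sum and product -/

namespace Dyad

/-- The dyadic zero `0 · 2^0`. [folklore] -/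
def zero : Dyad := ⟨0, 0⟩

/-- The dyadic one `1 · 2^0`. [folklore] -/
def one : Dyad := ⟨1, 0⟩

/-- [folklore] -/
@[simp] theorem toReal_zero : zero.toReal = 0 := by simp [zero, toReal]

/-- [folklore] -/
@[simp] theorem toReal_one : one.toReal = 1 := by simp [one, toReal]

/-- UPWARD-rounded sum. [folklore] -/
def addUp (prec : ℕ) (a b : Dyad) : Dyad := roundUp prec (add a b)

/-- UPWARD-rounded product. [folklore] -/
def mulUp (prec : ℕ) (a b : Dyad) : Dyad := roundUp prec (mul a b)

/-- DOWNWARD-rounded product (for chosen point objects; no inclusion claim is made about it). [folklore] -/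
def mulDn (prec : ℕ) (a b : Dyad) : Dyad := roundDown prec (mul a b)

/-- [folklore] -/
theorem add_le_addUp (prec : ℕ) (a b : Dyad) : a.toReal + b.toReal ≤ (addUp prec a b).toReal := by
  rw [← toReal_add]; exact le_roundUp prec _

/-- [folklore] -/
theorem mul_le_mulUp (prec : ℕ) (a b : Dyad) : a.toReal * b.toReal ≤ (mulUp prec a b).toReal := by
  rw [← toReal_mul]; exact le_roundUp prec _

/-- `toReal d = 0` iff `d.m = 0`. [folklore] -/
theorem toReal_eq_zero_iff (d : Dyad) : d.toReal = 0 ↔ d.m = 0 := by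
  have hp : (0 : ℝ) < (2 : ℝ) ^ d.e := zpow_pos (by norm_num) _
  simp only [toReal, mul_eq_zero, Int.cast_eq_zero, hp.ne', or_false]

end Dyad

/-! ### Array readers (junk zero beyond the size; used only below `n`) -/

/-- Entry `c` of a dyadic vector. [folklore] -/
def dget (v : Array Dyad) (c : ℕ) : Dyad := if h : c < v.size then v[c] else Dyad.zero

/-- Row `r` of an array-coded matrix. [folklore] -/
def rowOf {α : Type} (A : Array (Array α)) (r : ℕ) : Array α := if h : r < A.size then A[r] else #[]

/-- Entry `(r, c)` of a dyadic matrix. [folklore] -/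
def dmget (A : Array (Array Dyad)) (r c : ℕ) : Dyad := dget (rowOf A r) c

/-- Entry `(r, c)` of an interval matrix. [folklore] -/
def imget (M : Array (Array IntervalD)) (r c : ℕ) : IntervalD := IntervalD.aget (rowOf M r) c

/-- The real number at entry `c` of a dyadic vector. [folklore] -/
noncomputable def vre (v : Array Dyad) (c : ℕ) : ℝ := (dget v c).toReal

/-- The real matrix (in coordinates) of a dyadic matrix. [folklore] -/
noncomputable def dre (A : Array (Array Dyad)) (r c : ℕ) : ℝ := (dmget A r c).toReal

/-- `dget` of `Array.ofFn`. [folklore] -/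
theorem dget_ofFn {n : ℕ} (f : Fin n → Dyad) {c : ℕ} (hc : c < n) : dget (Array.ofFn f) c = f ⟨c, hc⟩ := by
  unfold dget
  rw [dif_pos (by rw [Array.size_ofFn]; exact hc), Array.getElem_ofFn]

/-- `rowOf` of `Array.ofFn`. [folklore] -/
theorem rowOf_ofFn {α : Type} {n : ℕ} (f : Fin n → Array α) {r : ℕ} (hr : r < n) : rowOf (Array.ofFn f) r = f ⟨r, hr⟩ := by
  unfold rowOf
  rw [dif_pos (by rw [Array.size_ofFn]; exact hr), Array.getElem_ofFn]

/-- `dmget` of a row-wise `Array.ofFn`-built matrix. [folklore] -/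
theorem dmget_ofFn_row {n : ℕ} (g : Fin n → Array Dyad) {r : ℕ} (c : ℕ) (hr : r < n) :
    dmget (Array.ofFn g) r c = dget (g ⟨r, hr⟩) c := by
  unfold dmget; rw [rowOf_ofFn g hr]

/-- `imget` of a row-wise `Array.ofFn`-built matrix. [folklore] -/
theorem imget_ofFn_row {n : ℕ} (g : Fin n → Array IntervalD) {r : ℕ} (c : ℕ) (hr : r < n) :
    imget (Array.ofFn g) r c = IntervalD.aget (g ⟨r, hr⟩) c := by
  unfold imget; rw [rowOf_ofFn g hr]

/-! ### Real semantics of the array-coded objects -/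

/-- The real `n × n` matrix `a` (in coordinates) lies ENTRYWISE in the interval matrix `M`. [folklore] -/
def MemMat (n : ℕ) (a : ℕ → ℕ → ℝ) (M : Array (Array IntervalD)) : Prop :=
  ∀ r < n, ∀ c < n, IntervalD.mem (a r c) (imget M r c)

/-- The real vector `v` lies coordinatewise in the interval vector `V`. [folklore] -/
def MemVec (n : ℕ) (v : ℕ → ℝ) (V : Array IntervalD) : Prop :=
  ∀ c < n, IntervalD.mem (v c) (IntervalD.aget V c)

/-- Entrywise absolute bound of a real matrix by a dyadic matrix. [folklore] -/
def AbsLeMat (n : ℕ) (a : ℕ → ℕ → ℝ) (A : Array (Array Dyad)) : Prop := ∀ r < n, ∀ c < n, |a r c| ≤ dre A r c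

/-- Coordinatewise absolute bound of a real vector by a dyadic vector. [folklore] -/
def AbsLeVec (n : ℕ) (v : ℕ → ℝ) (R : Array Dyad) : Prop := ∀ c < n, |v c| ≤ vre R c

/-! ### Scalar interval products with zero-skipping -/

namespace IntervalD

variable {x y : ℝ} {I J : IntervalD}

/-- `I` is the point interval `0` (both mantissas vanish). [folklore] -/
def isZero (I : IntervalD) : Bool := (I.lo.m == 0) && (I.hi.m == 0)

/-- A member of a zero point interval is `0`. [folklore] -/
theorem eq_zero_of_isZero (h : isZero I = true) (hx : mem x I) : x = 0 := by
  simp only [isZero, Bool.and_eq_true, beq_iff_eq] at h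
  have h1 : I.lo.toReal = 0 := (Dyad.toReal_eq_zero_iff _).2 h.1
  have h2 : I.hi.toReal = 0 := (Dyad.toReal_eq_zero_iff _).2 h.2
  have := hx.1; have := hx.2; linarith

/-- Rounded product interval × interval, skipping zero factors. [folklore] -/
def mulZ (prec : ℕ) (I J : IntervalD) : IntervalD := if isZero I || isZero J then ofInt 0 else mulR prec I J

/-- [folklore] -/
theorem mem_mulZ (prec : ℕ) (hx : mem x I) (hy : mem y J) : mem (x * y) (mulZ prec I J) := by
  unfold mulZ
  split_ifs with h
  · rcases Bool.or_eq_true_iff.1 h with h | h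
    · rw [eq_zero_of_isZero h hx, zero_mul]; exact mem_zero
    · rw [eq_zero_of_isZero h hy, mul_zero]; exact mem_zero
  · exact mem_mulR prec hx hy

/-- Rounded product dyadic POINT × interval, skipping zero factors. [folklore] -/
def mulDZ (prec : ℕ) (d : Dyad) (J : IntervalD) : IntervalD :=
  if (d.m == 0) || isZero J then ofInt 0 else roundOut prec (mulDyad J d)

/-- [folklore] -/
theorem mem_mulDZ (prec : ℕ) (d : Dyad) (hy : mem y J) : mem (d.toReal * y) (mulDZ prec d J) := by
  unfold mulDZ
  split_ifs with h
  · simp only [Bool.or_eq_true, beq_iff_eq] at h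
    rcases h with h | h
    · rw [(Dyad.toReal_eq_zero_iff d).2 h, zero_mul]; exact mem_zero
    · rw [eq_zero_of_isZero h hy, mul_zero]; exact mem_zero
  · rw [mul_comm]; exact mem_roundOut prec (mem_mulDyad hy d)

/-- Product of two dyadic points as a rounded interval, skipping zero factors. [folklore] -/
def mulDD (prec : ℕ) (a b : Dyad) : IntervalD :=
  if (a.m == 0) || (b.m == 0) then ofInt 0 else roundOut prec (ofDyad (Dyad.mul a b))

/-- [folklore] -/
theorem mem_mulDD (prec : ℕ) (a b : Dyad) : mem (a.toReal * b.toReal) (mulDD prec a b) := by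
  unfold mulDD
  split_ifs with h
  · simp only [Bool.or_eq_true, beq_iff_eq] at h
    rcases h with h | h
    · rw [(Dyad.toReal_eq_zero_iff a).2 h, zero_mul]; exact mem_zero
    · rw [(Dyad.toReal_eq_zero_iff b).2 h, mul_zero]; exact mem_zero
  · rw [← Dyad.toReal_mul]; exact mem_roundOut prec (mem_ofDyad _)

/-- `0 ≤ mag I`. [folklore] -/
theorem mag_nonneg (I : IntervalD) : 0 ≤ (mag I).toReal := by
  simp only [mag, Dyad.toReal_max, Dyad.toReal_abs]
  exact (abs_nonneg _).trans (le_max_left _ _)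

end IntervalD

/-! ### Interval matrix products -/

section Products

/-- Transpose of an `n × n` interval matrix. [folklore] -/
def transposeI (n : ℕ) (M : Array (Array IntervalD)) : Array (Array IntervalD) :=
  Array.ofFn (n := n) fun c => Array.ofFn (n := n) fun r => imget M r c

/-- Transpose of an `n × n` dyadic matrix. [folklore] -/
def transposeD (n : ℕ) (A : Array (Array Dyad)) : Array (Array Dyad) :=
  Array.ofFn (n := n) fun c => Array.ofFn (n := n) fun r => dmget A r c

/-- [folklore] -/
theorem imget_transposeI {n : ℕ} (M : Array (Array IntervalD)) {r c : ℕ} (hr : r < n) (hc : c < n) :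
    imget (transposeI n M) c r = imget M r c := by
  simp only [transposeI, imget_ofFn_row _ r hc, IntervalD.aget_ofFn _ hr]

/-- [folklore] -/
theorem dmget_transposeD {n : ℕ} (A : Array (Array Dyad)) {r c : ℕ} (hr : r < n) (hc : c < n) :
    dmget (transposeD n A) c r = dmget A r c := by
  simp only [transposeD, dmget_ofFn_row _ r hc, dget_ofFn _ hr]

/-- One row of `mulII`: `c ↦ Σ_{t<n} Mr[t]·NT[c][t]` (rounded, zero-skipping). [folklore] -/
def mulIIRow (n prec : ℕ) (Mr : Array IntervalD) (NT : Array (Array IntervalD)) : Array IntervalD :=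
  Array.ofFn (n := n) fun c =>
    let Nc := rowOf NT c
    IntervalD.rangeSumR prec (fun t => IntervalD.mulZ prec (IntervalD.aget Mr t) (IntervalD.aget Nc t)) n

/-- Interval × interval product (rounded, zero-skipping): entry `(r,c)` encloses `Σ_{t<n} a r t · b t c`. [folklore] -/
def mulII (n prec : ℕ) (M N : Array (Array IntervalD)) : Array (Array IntervalD) :=
  let NT := transposeI n N
  Array.ofFn (n := n) fun r => mulIIRow n prec (rowOf M r) NT

/-- One row of `mulDI`. [folklore] -/
def mulDIRow (n prec : ℕ) (Xr : Array Dyad) (NT : Array (Array IntervalD)) : Array IntervalD :=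
  Array.ofFn (n := n) fun c =>
    let Nc := rowOf NT c
    IntervalD.rangeSumR prec (fun t => IntervalD.mulDZ prec (dget Xr t) (IntervalD.aget Nc t)) n

/-- Dyadic point × interval product: entry `(r,c)` encloses `Σ_{t<n} dre X r t · b t c`. [folklore] -/
def mulDI (n prec : ℕ) (X : Array (Array Dyad)) (N : Array (Array IntervalD)) : Array (Array IntervalD) :=
  let NT := transposeI n N
  Array.ofFn (n := n) fun r => mulDIRow n prec (rowOf X r) NT

/-- One row of `mulID`. [folklore] -/
def mulIDRow (n prec : ℕ) (Mr : Array IntervalD) (CT : Array (Array Dyad)) : Array IntervalD :=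
  Array.ofFn (n := n) fun c =>
    let Cc := rowOf CT c
    IntervalD.rangeSumR prec (fun t => IntervalD.mulDZ prec (dget Cc t) (IntervalD.aget Mr t)) n

/-- Interval × dyadic point product: entry `(r,c)` encloses `Σ_{t<n} a r t · dre C t c`. [folklore] -/
def mulID (n prec : ℕ) (M : Array (Array IntervalD)) (C : Array (Array Dyad)) : Array (Array IntervalD) :=
  let CT := transposeD n C
  Array.ofFn (n := n) fun r => mulIDRow n prec (rowOf M r) CT

/-- One row of `oneSubMulDD`. [folklore] -/
def oneSubMulDDRow (n prec : ℕ) (r : ℕ) (Xr : Array Dyad) (CT : Array (Array Dyad)) : Array IntervalD :=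
  Array.ofFn (n := n) fun c =>
    let Cc := rowOf CT c
    IntervalD.subR prec (if r = c then IntervalD.ofInt 1 else IntervalD.ofInt 0)
      (IntervalD.rangeSumR prec (fun t => IntervalD.mulDD prec (dget Xr t) (dget Cc t)) n)

/-- The enclosure of `I − X·C` for two dyadic point matrices (input of the Neumann test). [folklore] -/
def oneSubMulDD (n prec : ℕ) (X C : Array (Array Dyad)) : Array (Array IntervalD) :=
  let CT := transposeD n C
  Array.ofFn (n := n) fun r => oneSubMulDDRow n prec r (rowOf X r) CT

/-- `Σ_{t<k} Ar[t]·Bc[t]` rounded DOWN after each step (chosen object; no inclusion claim). [folklore] -/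
def dotDn (prec : ℕ) (Ar Bc : Array Dyad) : ℕ → Dyad
  | 0 => Dyad.zero
  | t + 1 => Dyad.roundDown prec (Dyad.add (dotDn prec Ar Bc t) (Dyad.mul (dget Ar t) (dget Bc t)))

/-- Dyadic point × point product rounded DOWN to `prec`-bit points (chosen object, e.g. the frame update; NO inclusion
claim). [folklore] -/
def mulDDr (n prec : ℕ) (A B : Array (Array Dyad)) : Array (Array Dyad) :=
  let BT := transposeD n B
  Array.ofFn (n := n) fun r =>
    let Ar := rowOf A r
    Array.ofFn (n := n) fun c => dotDn prec Ar (rowOf BT c) n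

variable {n : ℕ} (prec : ℕ)

/-- **Inclusion isotonicity of the interval matrix product.** [folklore] -/
theorem memMat_mulII {a b : ℕ → ℕ → ℝ} {M N : Array (Array IntervalD)} (ha : MemMat n a M) (hb : MemMat n b N) :
    MemMat n (fun r c => ∑ t ∈ Finset.range n, a r t * b t c) (mulII n prec M N) := by
  intro r hr c hc
  simp only [mulII, mulIIRow, imget_ofFn_row _ c hr, IntervalD.aget_ofFn _ hc]
  refine IntervalD.mem_rangeSumR prec n fun t ht => IntervalD.mem_mulZ prec (ha r hr t ht) ?_
  have e : IntervalD.aget (rowOf (transposeI n N) c) t = imget N t c := imget_transposeI N ht hc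
  rw [e]; exact hb t ht c hc

/-- Point × interval inclusion. [folklore] -/
theorem memMat_mulDI {b : ℕ → ℕ → ℝ} (X : Array (Array Dyad)) {N : Array (Array IntervalD)} (hb : MemMat n b N) :
    MemMat n (fun r c => ∑ t ∈ Finset.range n, dre X r t * b t c) (mulDI n prec X N) := by
  intro r hr c hc
  simp only [mulDI, mulDIRow, imget_ofFn_row _ c hr, IntervalD.aget_ofFn _ hc]
  refine IntervalD.mem_rangeSumR prec n fun t ht => ?_
  have e : IntervalD.aget (rowOf (transposeI n N) c) t = imget N t c := imget_transposeI N ht hc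
  rw [e]; exact IntervalD.mem_mulDZ prec _ (hb t ht c hc)

/-- Interval × point inclusion. [folklore] -/
theorem memMat_mulID {a : ℕ → ℕ → ℝ} {M : Array (Array IntervalD)} (ha : MemMat n a M) (C : Array (Array Dyad)) :
    MemMat n (fun r c => ∑ t ∈ Finset.range n, a r t * dre C t c) (mulID n prec M C) := by
  intro r hr c hc
  simp only [mulID, mulIDRow, imget_ofFn_row _ c hr, IntervalD.aget_ofFn _ hc]
  refine IntervalD.mem_rangeSumR prec n fun t ht => ?_
  have e : dget (rowOf (transposeD n C) c) t = dmget C t c := dmget_transposeD C ht hc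
  rw [e, mul_comm]; exact IntervalD.mem_mulDZ prec _ (ha r hr t ht)

/-- **`I − X·C` lies in `oneSubMulDD X C`.** [folklore] -/
theorem memMat_oneSubMulDD (X C : Array (Array Dyad)) :
    MemMat n (fun r c => (if r = c then (1 : ℝ) else 0) - ∑ t ∈ Finset.range n, dre X r t * dre C t c)
      (oneSubMulDD n prec X C) := by
  intro r hr c hc
  simp only [oneSubMulDD, oneSubMulDDRow, imget_ofFn_row _ c hr, IntervalD.aget_ofFn _ hc]
  refine IntervalD.mem_subR prec ?_ (IntervalD.mem_rangeSumR prec n fun t ht => ?_)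
  · split_ifs
    · simpa using IntervalD.mem_ofInt 1
    · exact IntervalD.mem_zero
  · have e : dget (rowOf (transposeD n C) c) t = dmget C t c := dmget_transposeD C ht hc
    rw [e]; exact IntervalD.mem_mulDD prec _ _

end Products

end Summit.NavierStokesRegularity.NavierStokesRegularity.Theorems.TaylorModelCert
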